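import Literature.NumberTheory.CubicFields.PureCubicLatticeCodes
import Literature.NumberTheory.NumberFields.CubicIntegralityCriterion
import Mathlib.NumberTheory.NumberField.Basic
import Mathlib.Tactic.FieldSimp
import Mathlib.Tactic.IntervalCases
import Mathlib.Tactic.LinearCombination
import HarnessLib

/-!
# The maximal order of a pure cubic field as a canonical lattice code: saturation of `ℤ[θ, θ₂]`

Topic `NumberTheory/CubicFields`; theorem-only sequel of `PureCubicLatticeCodes.lean` (codes
`Canon`, `Mem`, `val` of lattices and elements of `K = ℚ(θ)`, `θ³ = ab²`, `θ₂ = θ²/b`) and of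
`NumberFields/CubicIntegralityCriterion.lean`. Dedekind's order `𝒪 = ℤ + ℤθ + ℤθ₂` has index
dividing `3` in `𝓞_K` (`3 · 𝓞_K ⊆ 𝒪`), so

  `𝓞_K = 𝒪 + Σ ℤ ν` over the candidates `ν = (x + yθ + zθ₂)/3`, `(x, y, z) ∈ {0,1,2}³ ∖ {0}`,
  that are algebraic integers

(every `ξ ∈ 𝓞_K` is congruent modulo `𝒪` to such a candidate or to `0`). This file proves the
correctness of the corresponding SATURATION LOOP on lattice codes, abstractly in the program
`add` ("lattice + one generator", specified by `Canon`/`Mem` as in the consuming statements) and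
in a Boolean `test` deciding integrality of the candidates:

* `mem_add`, `canon_orderCode`, `mem_orderCode_iff` — the code `(1, [1,0,0,1,0,1])` of `𝒪`;
* `exists_residue` — `ξ ∈ 𝓞_K ⟹ ξ = ψ + val (r₀, r₁, r₂, 3)`, `ψ ∈ 𝒪`, `0 ≤ rᵢ < 3`;
* `isIntegral_val_iff`, `test_val_iff` — the EXACT integrality test of an element code of
  denominator `3` from the code of its square and its norm (trace form `Tr(x + yθ + zθ₂) = 3x`
  and `CubicIntegralityCriterion`): `2·den(ν²) ∣ x²·den(ν²) − 3·num₁(ν²)` and `den(Nν) ∣ num(Nν)`;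
* `foldl_invariant`, **`orderCode_spec`** — folding `c ↦ if test e then add c e else c` over the
  `26` candidates from the code of `𝒪` yields a canonical code whose member set is exactly the
  set of algebraic integers of `K`.

The polynomial-time realisation of the loop on codes is not here (it is three `CodeFP`
compositions at the use site).

## References

* H. Cohen, *A Course in Computational Algebraic Number Theory*, GTM 138, Springer 1993, §6.4.5
  (integral basis of pure cubic fields), §4.7.1 (HNF codes of modules), Algorithm 6.1.8
  (saturation by integral elements of `p`-power denominator). [Cohen1993]
* R. Dedekind, *Über die Anzahl der Idealklassen in reinen kubischen Zahlkörpern*, J. reine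
  angew. Math. 121 (1900), 40–123.
-/

namespace Literature.NumberTheory.CubicFields

namespace PureCubicOrderCode

open PureCubicCodes (Canon Mem val)
open scoped NumberField

variable {K : Type*} [Field K]

/-! ### Member sets of codes: additivity, the code of Dedekind's order -/

/-- Member sets of lattice codes are closed under addition. [folklore] -/
theorem mem_add (θ : K) (b : ℕ) {c : ℕ × List ℤ} {φ ψ : K} (hφ : Mem θ b c φ) (hψ : Mem θ b c ψ) :
    Mem θ b c (φ + ψ) := by
  obtain ⟨h11, h12, h13, h22, h23, h33, u, v, w, hc, e⟩ := hφ
  obtain ⟨g11, g12, g13, g22, g23, g33, u', v', w', hc', e'⟩ := hψ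
  rw [hc] at hc'
  simp only [List.cons.injEq, and_true] at hc'
  obtain ⟨rfl, rfl, rfl, rfl, rfl, rfl⟩ := hc'
  refine ⟨h11, h12, h13, h22, h23, h33, u + u', v + v', w + w', hc, ?_⟩
  rw [mul_add, e, e']
  push_cast
  ring

/-- The code `(1, [1, 0, 0, 1, 0, 1])` of Dedekind's order `ℤ + ℤθ + ℤθ₂` is canonical.
[folklore] -/
theorem canon_orderCode : Canon ((1 : ℕ), [(1 : ℤ), 0, 0, 1, 0, 1]) :=
  ⟨1, 0, 0, 1, 0, 1, rfl, by decide, by decide, by decide, le_rfl, by decide, le_rfl, by decide,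
    le_rfl, by decide, le_rfl, by decide⟩

/-- The member set of the code `(1, [1, 0, 0, 1, 0, 1])` is Dedekind's order
`{u + vθ + wθ₂ : u, v, w ∈ ℤ}`. [folklore] -/
theorem mem_orderCode_iff (θ : K) (b : ℕ) (φ : K) :
    Mem θ b ((1 : ℕ), [(1 : ℤ), 0, 0, 1, 0, 1]) φ ↔
      ∃ u v w : ℤ, φ = (u : K) + (v : K) * θ + (w : K) * (θ ^ 2 / (b : K)) := by
  constructor
  · rintro ⟨h11, h12, h13, h22, h23, h33, u, v, w, hc, e⟩
    simp only [List.cons.injEq, and_true] at hc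
    obtain ⟨rfl, rfl, rfl, rfl, rfl, rfl⟩ := hc
    refine ⟨u, v, w, ?_⟩
    rw [Nat.cast_one, one_mul] at e
    rw [e]
    push_cast
    ring
  · rintro ⟨u, v, w, rfl⟩
    refine ⟨1, 0, 0, 1, 0, 1, u, v, w, rfl, ?_⟩
    push_cast
    ring

/-- The member set of the code of `𝒪` contains `0`. [folklore] -/
theorem mem_orderCode_zero (θ : K) (b : ℕ) : Mem θ b ((1 : ℕ), [(1 : ℤ), 0, 0, 1, 0, 1]) 0 :=
  (mem_orderCode_iff θ b 0).2 ⟨0, 0, 0, by push_cast; ring⟩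

/-- Elements of Dedekind's order are algebraic integers (given that `θ`, `θ₂` are). [folklore] -/
theorem isIntegral_combo {θ : K} {b : ℕ} (hθ : IsIntegral ℤ θ)
    (hθ₂ : IsIntegral ℤ (θ ^ 2 / (b : K))) (u v w : ℤ) :
    IsIntegral ℤ ((u : K) + (v : K) * θ + (w : K) * (θ ^ 2 / (b : K))) := by
  have hi : ∀ k : ℤ, IsIntegral ℤ (k : K) := fun k => by
    simpa using (isIntegral_algebraMap (R := ℤ) (A := K) (x := k))
  exact ((hi u).add ((hi v).mul hθ)).add ((hi w).mul hθ₂)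

/-! ### Residues modulo `𝒪` -/

/-- **Residue decomposition.** If `3ξ ∈ 𝒪` for every algebraic integer `ξ`, then every algebraic
integer is `ψ + (r₀ + r₁θ + r₂θ₂)/3` with `ψ ∈ 𝒪` and digits `0 ≤ rᵢ < 3`.
[cite: Cohen1993, §6.4.5] -/
theorem exists_residue [CharZero K] (θ : K) (b : ℕ)
    (h3O : ∀ ξ : K, IsIntegral ℤ ξ →
      ∃ c₀ c₁ c₂ : ℤ, (3 : K) * ξ = c₀ + c₁ * θ + c₂ * (θ ^ 2 / (b : K)))
    {ξ : K} (hξ : IsIntegral ℤ ξ) :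
    ∃ q₀ q₁ q₂ r₀ r₁ r₂ : ℤ, 0 ≤ r₀ ∧ r₀ < 3 ∧ 0 ≤ r₁ ∧ r₁ < 3 ∧ 0 ≤ r₂ ∧ r₂ < 3 ∧
      ξ = ((q₀ : K) + (q₁ : K) * θ + (q₂ : K) * (θ ^ 2 / (b : K))) + val θ b (r₀, r₁, r₂, 3) := by
  obtain ⟨c₀, c₁, c₂, h⟩ := h3O ξ hξ
  refine ⟨c₀ / 3, c₁ / 3, c₂ / 3, c₀ % 3, c₁ % 3, c₂ % 3, Int.emod_nonneg _ (by norm_num),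
    Int.emod_lt_of_pos _ (by norm_num), Int.emod_nonneg _ (by norm_num),
    Int.emod_lt_of_pos _ (by norm_num), Int.emod_nonneg _ (by norm_num),
    Int.emod_lt_of_pos _ (by norm_num), ?_⟩
  have h0 := Int.mul_ediv_add_emod c₀ 3
  have h1 := Int.mul_ediv_add_emod c₁ 3
  have h2 := Int.mul_ediv_add_emod c₂ 3
  have h3 : (3 : K) ≠ 0 := by norm_num
  apply mul_left_cancel₀ h3
  rw [h]
  simp only [val, Nat.cast_ofNat]
  rw [mul_add, mul_div_cancel₀ _ h3]
  have e0 : (c₀ : K) = 3 * ((c₀ / 3 : ℤ) : K) + ((c₀ % 3 : ℤ) : K) := by exact_mod_cast h0.symm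
  have e1 : (c₁ : K) = 3 * ((c₁ / 3 : ℤ) : K) + ((c₁ % 3 : ℤ) : K) := by exact_mod_cast h1.symm
  have e2 : (c₂ : K) = 3 * ((c₂ / 3 : ℤ) : K) + ((c₂ % 3 : ℤ) : K) := by exact_mod_cast h2.symm
  rw [e0, e1, e2]
  ring

/-! ### The exact integrality test for candidates of denominator `3` -/

/-- The value of an element code in `ℚ`-coordinates. [folklore] -/
theorem val_eq_ratCast [CharZero K] (θ : K) (b : ℕ) (e : ℤ × ℤ × ℤ × ℕ) :
    val θ b e = (((e.1 : ℚ) / (e.2.2.2 : ℚ) : ℚ) : K) +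
      (((e.2.1 : ℚ) / (e.2.2.2 : ℚ) : ℚ) : K) * θ +
      (((e.2.2.1 : ℚ) / (e.2.2.2 : ℚ) : ℚ) : K) * (θ ^ 2 / (b : K)) := by
  simp only [val]
  push_cast
  ring

/-- The trace of the value of an element code: `Tr((x + yθ + zθ₂)/den) = 3x/den`, from the trace
form `Tr(x + yθ + zθ₂) = 3x`. [cite: Cohen1993, §6.4.5] -/
theorem trace_val [NumberField K] (θ : K) (b : ℕ)
    (htr : ∀ x y z : ℚ,
      Algebra.trace ℚ K ((x : K) + (y : K) * θ + (z : K) * (θ ^ 2 / (b : K))) = 3 * x)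
    (e : ℤ × ℤ × ℤ × ℕ) : Algebra.trace ℚ K (val θ b e) = 3 * (e.1 : ℚ) / (e.2.2.2 : ℚ) := by
  rw [val_eq_ratCast, htr]
  ring

/-- `N/D ∈ ℤ` iff `D ∣ N` (`D ≥ 1`). [folklore] -/
theorem exists_int_div_eq_iff (N : ℤ) {D : ℕ} (hD : 1 ≤ D) :
    (∃ n : ℤ, (N : ℚ) / (D : ℚ) = n) ↔ (D : ℤ) ∣ N := by
  have hD' : (D : ℚ) ≠ 0 := by exact_mod_cast (by omega : D ≠ 0)
  constructor
  · rintro ⟨n, hn⟩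
    rw [div_eq_iff hD'] at hn
    exact ⟨n, by exact_mod_cast (by linarith : (N : ℚ) = D * n)⟩
  · rintro ⟨k, rfl⟩
    exact ⟨k, by push_cast; field_simp⟩

/-- `P − M/D ∈ 2ℤ` iff `2D ∣ PD − M` (`D ≥ 1`). [folklore] -/
theorem exists_int_sub_div_eq_iff (P M : ℤ) {D : ℕ} (hD : 1 ≤ D) :
    (∃ s : ℤ, (P : ℚ) - (M : ℚ) / (D : ℚ) = 2 * s) ↔ 2 * (D : ℤ) ∣ P * D - M := by
  have hD' : (D : ℚ) ≠ 0 := by exact_mod_cast (by omega : D ≠ 0)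
  constructor
  · rintro ⟨s, hs⟩
    refine ⟨s, ?_⟩
    have : ((P * D - M : ℤ) : ℚ) = ((2 * D * s : ℤ) : ℚ) := by
      push_cast
      have := hs
      field_simp at this
      linear_combination this
    exact_mod_cast this
  · rintro ⟨k, hk⟩
    refine ⟨k, ?_⟩
    have hk' : (P : ℚ) * D - M = 2 * D * k := by exact_mod_cast hk
    field_simp
    linear_combination hk'

/-- **Exact integrality test for an element code of denominator `3`.** With `m` a code of `ν²`
(`ν = val e`) and `nr = (num, den)` of `N(ν)`: `ν` is an algebraic integer iff
`2·den(m) ∣ x²·den(m) − 3·m₁` (i.e. `e₂(ν) = (Tr(ν)² − Tr(ν²))/2 ∈ ℤ`, as `Tr ν = x`,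
`Tr ν² = 3m₁/den(m)`) and `den ∣ num` (`N ν ∈ ℤ`). [cite: Cohen1993, §6.4.5] -/
theorem isIntegral_val_iff [NumberField K] (θ : K) (b : ℕ) (h3 : Module.finrank ℚ K = 3)
    (htr : ∀ x y z : ℚ,
      Algebra.trace ℚ K ((x : K) + (y : K) * θ + (z : K) * (θ ^ 2 / (b : K))) = 3 * x)
    (e m : ℤ × ℤ × ℤ × ℕ) (he : e.2.2.2 = 3) (hm1 : 1 ≤ m.2.2.2)
    (hm : val θ b m = val θ b e * val θ b e) (nr : ℤ × ℕ) (hn1 : 1 ≤ nr.2)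
    (hnr : ((nr.1 : ℤ) : ℚ) / ((nr.2 : ℕ) : ℚ) = Algebra.norm ℚ (val θ b e)) :
    IsIntegral ℤ (val θ b e) ↔
      (2 * (m.2.2.2 : ℤ) ∣ e.1 * e.1 * m.2.2.2 - 3 * m.1) ∧ ((nr.2 : ℤ) ∣ nr.1) := by
  rw [Literature.NumberTheory.NumberFields.isIntegral_iff_trace_norm h3, sq (val θ b e), ← hm,
    trace_val θ b htr e, trace_val θ b htr m, he, ← hnr, exists_int_div_eq_iff _ hn1]
  have h3x : 3 * (e.1 : ℚ) / ((3 : ℕ) : ℚ) = e.1 := by push_cast; ring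
  rw [h3x, show (e.1 : ℚ) ^ 2 = ((e.1 * e.1 : ℤ) : ℚ) by push_cast; ring,
    show 3 * (m.1 : ℚ) / (m.2.2.2 : ℚ) = ((3 * m.1 : ℤ) : ℚ) / (m.2.2.2 : ℚ) by push_cast; ring,
    exists_int_sub_div_eq_iff _ _ hm1]
  exact ⟨fun h => ⟨h.2.1, h.2.2⟩, fun h => ⟨⟨e.1, rfl⟩, h.1, h.2⟩⟩

/-- The division-free Boolean divisibility test `N − D·(N/D) = 0`. [folklore] -/
theorem decide_sub_mul_ediv_eq_zero (N D : ℤ) : decide (N - D * (N / D) = 0) = true ↔ D ∣ N := by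
  rw [decide_eq_true_iff, sub_eq_zero]
  exact ⟨fun h => ⟨N / D, h⟩, fun h => (Int.mul_ediv_cancel' h).symm⟩

/-- **The Boolean integrality test** of a candidate code `e` (denominator `3`) computed from the
code `m` of its square and the code `nr` of its norm is correct. [cite: Cohen1993, §6.4.5] -/
theorem test_val_iff [NumberField K] (θ : K) (b : ℕ) (h3 : Module.finrank ℚ K = 3)
    (htr : ∀ x y z : ℚ,
      Algebra.trace ℚ K ((x : K) + (y : K) * θ + (z : K) * (θ ^ 2 / (b : K))) = 3 * x)
    (e m : ℤ × ℤ × ℤ × ℕ) (he : e.2.2.2 = 3) (hm1 : 1 ≤ m.2.2.2)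
    (hm : val θ b m = val θ b e * val θ b e) (nr : ℤ × ℕ) (hn1 : 1 ≤ nr.2)
    (hnr : ((nr.1 : ℤ) : ℚ) / ((nr.2 : ℕ) : ℚ) = Algebra.norm ℚ (val θ b e)) :
    (decide (e.1 * e.1 * m.2.2.2 - 3 * m.1 -
          2 * (m.2.2.2 : ℤ) * ((e.1 * e.1 * m.2.2.2 - 3 * m.1) / (2 * (m.2.2.2 : ℤ))) = 0) &&
        decide (nr.1 - (nr.2 : ℤ) * (nr.1 / (nr.2 : ℤ)) = 0)) = true ↔
      IsIntegral ℤ (val θ b e) := by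
  rw [Bool.and_eq_true, decide_sub_mul_ediv_eq_zero, decide_sub_mul_ediv_eq_zero,
    isIntegral_val_iff θ b h3 htr e m he hm1 hm nr hn1 hnr]

/-! ### The saturation loop -/

/-- **Invariant of the saturation loop.** Along the fold `c ↦ if test e then add c e else c` over
codes `e` of denominator `3` (with `add` = "lattice + one generator" on canonical codes and `test`
deciding integrality of such codes), the code stays canonical, its members stay algebraic
integers, it keeps containing the start code's members, and it acquires every processed integral
candidate. [cite: Cohen1993, Algorithm 6.1.8] -/
theorem foldl_invariant (θ : K) (b : ℕ)
    (add : ℕ × List ℤ → ℤ × ℤ × ℤ × ℕ → ℕ × List ℤ) (test : ℤ × ℤ × ℤ × ℕ → Bool) (c₀ : ℕ × List ℤ)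
    (h0 : Mem θ b c₀ 0)
    (hadd : ∀ (c : ℕ × List ℤ) (e : ℤ × ℤ × ℤ × ℕ), Canon c → 1 ≤ e.2.2.2 →
      Canon (add c e) ∧ ∀ φ : K, Mem θ b (add c e) φ ↔
        ∃ (ψ : K) (k : ℤ), Mem θ b c ψ ∧ φ = ψ + (k : K) * val θ b e)
    (htest : ∀ e : ℤ × ℤ × ℤ × ℕ, e.2.2.2 = 3 → (test e = true ↔ IsIntegral ℤ (val θ b e))) :
    ∀ (L L₀ : List (ℤ × ℤ × ℤ × ℕ)) (c : ℕ × List ℤ), (∀ e ∈ L, e.2.2.2 = 3) →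
      (Canon c ∧ (∀ φ, Mem θ b c φ → IsIntegral ℤ φ) ∧ (∀ φ, Mem θ b c₀ φ → Mem θ b c φ) ∧
        (∀ e ∈ L₀, IsIntegral ℤ (val θ b e) → Mem θ b c (val θ b e))) →
      (Canon (L.foldl (fun c e => if test e then add c e else c) c) ∧
        (∀ φ, Mem θ b (L.foldl (fun c e => if test e then add c e else c) c) φ → IsIntegral ℤ φ) ∧
        (∀ φ, Mem θ b c₀ φ → Mem θ b (L.foldl (fun c e => if test e then add c e else c) c) φ) ∧
        (∀ e ∈ L₀ ++ L, IsIntegral ℤ (val θ b e) →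
          Mem θ b (L.foldl (fun c e => if test e then add c e else c) c) (val θ b e))) := by
  intro L
  induction L with
  | nil => intro L₀ c _ h; simpa using h
  | cons e L ih =>
    rintro L₀ c hL ⟨h1, h2, h3, h4⟩
    have he3 : e.2.2.2 = 3 := hL e List.mem_cons_self
    have hLt : ∀ e' ∈ L, e'.2.2.2 = 3 := fun e' he' => hL e' (List.mem_cons_of_mem _ he')
    have key := ih (L₀ ++ [e]) (if test e then add c e else c) hLt ?_
    · simpa only [List.foldl_cons, List.append_assoc, List.singleton_append] using key
    by_cases ht : test e = true
    · rw [if_pos ht]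
      have hint : IsIntegral ℤ (val θ b e) := (htest e he3).1 ht
      obtain ⟨hc', hmem⟩ := hadd c e h1 (by omega)
      refine ⟨hc', ?_, ?_, ?_⟩
      · intro φ hφ
        obtain ⟨ψ, k, hψ, rfl⟩ := (hmem φ).1 hφ
        have hk : IsIntegral ℤ (k : K) := by
          simpa using (isIntegral_algebraMap (R := ℤ) (A := K) (x := k))
        exact (h2 ψ hψ).add (hk.mul hint)
      · intro φ hφ
        exact (hmem φ).2 ⟨φ, 0, h3 φ hφ, by simp⟩
      · intro e' he' hint'
        rcases List.mem_append.1 he' with h | h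
        · exact (hmem _).2 ⟨_, 0, h4 e' h hint', by simp⟩
        · rw [List.mem_singleton] at h
          subst h
          exact (hmem _).2 ⟨0, 1, h3 0 h0, by simp⟩
    · rw [if_neg ht]
      refine ⟨h1, h2, h3, ?_⟩
      intro e' he' hint'
      rcases List.mem_append.1 he' with h | h
      · exact h4 e' h hint'
      · rw [List.mem_singleton] at h
        subst h
        exact absurd ((htest _ he3).2 hint') ht

/-- The `26` candidate codes `(x, y, z, 3)`, `(x, y, z) ∈ {0,1,2}³ ∖ {0}`, all have denominator
`3`. [folklore] -/
theorem candidates_den :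
    ∀ e ∈
    ([(0, 0, 1, 3), (0, 0, 2, 3), (0, 1, 0, 3), (0, 1, 1, 3), (0, 1, 2, 3), (0, 2, 0, 3),
      (0, 2, 1, 3), (0, 2, 2, 3), (1, 0, 0, 3), (1, 0, 1, 3), (1, 0, 2, 3), (1, 1, 0, 3),
      (1, 1, 1, 3), (1, 1, 2, 3), (1, 2, 0, 3), (1, 2, 1, 3), (1, 2, 2, 3), (2, 0, 0, 3),
      (2, 0, 1, 3), (2, 0, 2, 3), (2, 1, 0, 3), (2, 1, 1, 3), (2, 1, 2, 3), (2, 2, 0, 3),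
      (2, 2, 1, 3), (2, 2, 2, 3)] : List (ℤ × ℤ × ℤ × ℕ)), e.2.2.2 = 3 := by
  decide

/-- The `26` candidate codes cover all digit vectors `(r₀, r₁, r₂) ≠ 0`, `0 ≤ rᵢ < 3`. [folklore] -/
theorem candidates_cover (r₀ r₁ r₂ : ℤ) (h₀ : 0 ≤ r₀) (h₀' : r₀ < 3) (h₁ : 0 ≤ r₁) (h₁' : r₁ < 3)
    (h₂ : 0 ≤ r₂) (h₂' : r₂ < 3) :
    (r₀, r₁, r₂, (3 : ℕ)) ∈
    ([(0, 0, 1, 3), (0, 0, 2, 3), (0, 1, 0, 3), (0, 1, 1, 3), (0, 1, 2, 3), (0, 2, 0, 3),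
      (0, 2, 1, 3), (0, 2, 2, 3), (1, 0, 0, 3), (1, 0, 1, 3), (1, 0, 2, 3), (1, 1, 0, 3),
      (1, 1, 1, 3), (1, 1, 2, 3), (1, 2, 0, 3), (1, 2, 1, 3), (1, 2, 2, 3), (2, 0, 0, 3),
      (2, 0, 1, 3), (2, 0, 2, 3), (2, 1, 0, 3), (2, 1, 1, 3), (2, 1, 2, 3), (2, 2, 0, 3),
      (2, 2, 1, 3), (2, 2, 2, 3)] : List (ℤ × ℤ × ℤ × ℕ)) ∨ (r₀ = 0 ∧ r₁ = 0 ∧ r₂ = 0) := by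
  interval_cases r₀ <;> interval_cases r₁ <;> interval_cases r₂ <;> decide

/-- **The saturation loop computes the maximal order.** For `K` cubic, `θ, θ₂ = θ²/b` algebraic
integers with `3 · 𝓞_K ⊆ 𝒪 = ℤ + ℤθ + ℤθ₂`: folding `c ↦ if test e then add c e else c` over the
`26` candidates `(x + yθ + zθ₂)/3` from the code `(1, [1,0,0,1,0,1])` of `𝒪` — `add` being
"lattice + one generator" on canonical codes and `test` an exact integrality test on codes of
denominator `3` — returns a CANONICAL code whose member set is `{φ ∈ K : φ integral over ℤ}`.
[cite: Cohen1993, §6.4.5 and Algorithm 6.1.8] -/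
theorem orderCode_spec [CharZero K] (θ : K) (b : ℕ)
    (hθ : IsIntegral ℤ θ) (hθ₂ : IsIntegral ℤ (θ ^ 2 / (b : K)))
    (h3O : ∀ ξ : K, IsIntegral ℤ ξ →
      ∃ c₀ c₁ c₂ : ℤ, (3 : K) * ξ = c₀ + c₁ * θ + c₂ * (θ ^ 2 / (b : K)))
    (add : ℕ × List ℤ → ℤ × ℤ × ℤ × ℕ → ℕ × List ℤ) (test : ℤ × ℤ × ℤ × ℕ → Bool)
    (hadd : ∀ (c : ℕ × List ℤ) (e : ℤ × ℤ × ℤ × ℕ), Canon c → 1 ≤ e.2.2.2 →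
      Canon (add c e) ∧ ∀ φ : K, Mem θ b (add c e) φ ↔
        ∃ (ψ : K) (k : ℤ), Mem θ b c ψ ∧ φ = ψ + (k : K) * val θ b e)
    (htest : ∀ e : ℤ × ℤ × ℤ × ℕ, e.2.2.2 = 3 → (test e = true ↔ IsIntegral ℤ (val θ b e))) :
    Canon
    (([(0, 0, 1, 3), (0, 0, 2, 3), (0, 1, 0, 3), (0, 1, 1, 3), (0, 1, 2, 3), (0, 2, 0, 3),
      (0, 2, 1, 3), (0, 2, 2, 3), (1, 0, 0, 3), (1, 0, 1, 3), (1, 0, 2, 3), (1, 1, 0, 3),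
      (1, 1, 1, 3), (1, 1, 2, 3), (1, 2, 0, 3), (1, 2, 1, 3), (1, 2, 2, 3), (2, 0, 0, 3),
      (2, 0, 1, 3), (2, 0, 2, 3), (2, 1, 0, 3), (2, 1, 1, 3), (2, 1, 2, 3), (2, 2, 0, 3),
      (2, 2, 1, 3), (2, 2, 2, 3)] : List (ℤ × ℤ × ℤ × ℕ)).foldl
        (fun c e => if test e then add c e else c) ((1 : ℕ), [(1 : ℤ), 0, 0, 1, 0, 1])) ∧
    ∀ φ : K, Mem θ b
    (([(0, 0, 1, 3), (0, 0, 2, 3), (0, 1, 0, 3), (0, 1, 1, 3), (0, 1, 2, 3), (0, 2, 0, 3),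
      (0, 2, 1, 3), (0, 2, 2, 3), (1, 0, 0, 3), (1, 0, 1, 3), (1, 0, 2, 3), (1, 1, 0, 3),
      (1, 1, 1, 3), (1, 1, 2, 3), (1, 2, 0, 3), (1, 2, 1, 3), (1, 2, 2, 3), (2, 0, 0, 3),
      (2, 0, 1, 3), (2, 0, 2, 3), (2, 1, 0, 3), (2, 1, 1, 3), (2, 1, 2, 3), (2, 2, 0, 3),
      (2, 2, 1, 3), (2, 2, 2, 3)] : List (ℤ × ℤ × ℤ × ℕ)).foldl
        (fun c e => if test e then add c e else c) ((1 : ℕ), [(1 : ℤ), 0, 0, 1, 0, 1])) φ ↔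
      IsIntegral ℤ φ := by
  obtain ⟨I1, I2, I3, I4⟩ := foldl_invariant θ b add test ((1 : ℕ), [(1 : ℤ), 0, 0, 1, 0, 1])
    (mem_orderCode_zero θ b) hadd htest
    [(0, 0, 1, 3), (0, 0, 2, 3), (0, 1, 0, 3), (0, 1, 1, 3), (0, 1, 2, 3), (0, 2, 0, 3),
      (0, 2, 1, 3), (0, 2, 2, 3), (1, 0, 0, 3), (1, 0, 1, 3), (1, 0, 2, 3), (1, 1, 0, 3),
      (1, 1, 1, 3), (1, 1, 2, 3), (1, 2, 0, 3), (1, 2, 1, 3), (1, 2, 2, 3), (2, 0, 0, 3),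
      (2, 0, 1, 3), (2, 0, 2, 3), (2, 1, 0, 3), (2, 1, 1, 3), (2, 1, 2, 3), (2, 2, 0, 3),
      (2, 2, 1, 3), (2, 2, 2, 3)] [] ((1 : ℕ), [(1 : ℤ), 0, 0, 1, 0, 1])
    candidates_den ⟨canon_orderCode, fun φ hφ => by
      obtain ⟨u, v, w, rfl⟩ := (mem_orderCode_iff θ b φ).1 hφ
      exact isIntegral_combo hθ hθ₂ u v w, fun φ hφ => hφ, fun e he => by simp at he⟩
  refine ⟨I1, fun φ => ⟨I2 φ, fun hφ => ?_⟩⟩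
  obtain ⟨q₀, q₁, q₂, r₀, r₁, r₂, g₀, g₀', g₁, g₁', g₂, g₂', hdec⟩ := exists_residue θ b h3O hφ
  have hψ : Mem θ b ((1 : ℕ), [(1 : ℤ), 0, 0, 1, 0, 1])
      ((q₀ : K) + (q₁ : K) * θ + (q₂ : K) * (θ ^ 2 / (b : K))) :=
    (mem_orderCode_iff θ b _).2 ⟨q₀, q₁, q₂, rfl⟩
  rcases candidates_cover r₀ r₁ r₂ g₀ g₀' g₁ g₁' g₂ g₂' with hmem | ⟨rfl, rfl, rfl⟩
  · have hint : IsIntegral ℤ (val θ b (r₀, r₁, r₂, 3)) := by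
      have : val θ b (r₀, r₁, r₂, 3) =
          φ - ((q₀ : K) + (q₁ : K) * θ + (q₂ : K) * (θ ^ 2 / (b : K))) := by
        rw [hdec]; ring
      rw [this]
      exact hφ.sub (isIntegral_combo hθ hθ₂ q₀ q₁ q₂)
    rw [hdec]
    exact mem_add θ b (I3 _ hψ) (I4 _ (by simpa using hmem) hint)
  · have h0 : val θ b ((0 : ℤ), (0 : ℤ), (0 : ℤ), 3) = 0 := by simp [val]
    rw [hdec, h0, add_zero]
    exact I3 _ hψ

end PureCubicOrderCode

end Literature.NumberTheory.CubicFields
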